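import Summits.QuantumFields.YangMills.Theorems.UnitScaleTiltProp7UntwistChartSplit
import Summits.QuantumFields.YangMills.Theorems.UnitScaleTiltProp7PinnedRegaugeChartBCH
import Literature.MathematicalPhysics.QuantumFieldTheory.Balaban1983to89.MatrixLogLipschitz
import HarnessLib

/-!
# Prop 7, route-R E′, (E1-c) brick F2 — THE EXACT TRISECTION OF THE CHART REMAINDER
# `N = P₁ + P₂ + P₃`:  `P₁ = Ad(u)(log E) − log E` (rotation of the datum),  `P₂ = log(u·W·u₊*·W*) − (μ − W·μ₊·W*)` (the pure-gauge piece),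
# `P₃ = log(PQ) − log P − log Q` (the (31)-remainder of `P = Ad(u)E`, `Q = uWu₊*W*`) — with their sizes and Lipschitz rows

Route `UnitScaleTilt`, crux K1 child «MinimiserStabilityRegPr» (`stmt-QuantumFields-19200`), cell ym3-torus, width seat px15 (gen 2); pen «px15 g2: (E1-c) GO-LOCATE» (★p1 g15,
2026-08-28T20:45:05Z), LOCATE `LOCATE-E1C-DIVLIPSCHITZ-px15g2.md` §1∕§4 (F2).  THEOREMS ONLY (0 `def`, 0 `sorry`); `--supports stmt-QuantumFields-19200`, count-neutral.
YM₃ on T³ is a ladder rung (R3), not the Clay problem; nothing here claims the stub, the crux, d = 4 or the mass gap.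

WHY.  The exact corrector's nonlinearity is the chart remainder `N_b(ψ) = log((X‴)^{u})_bW_b⁻¹) − log(X‴_bW_b⁻¹) − (μ(b₋) − W_bμ(b₊)W_b*)`, `u = e^{μ}` the pinned gauge, `μ = −iψ`.  Its
divergence-Lipschitz row (LOCATE-E1 §3 (N) row 2; brick F4) needs `N` split into: a SITE COEFFICIENT on the ONE datum `log E` (`P₁`, resummed by F1's product rule against `D*_W(log E)`), the
PURE-GAUGE piece `P₂` (`E`-free; its `δ`-linear part `M_μ(δ)` is F3's `dexp` letter, resummed against `Δ_Wψ`), and a remainder with TWO `ℓ⁻¹`-small data (`P₃`, crude rule).  This file is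
the exact algebra of that split at the matrix level plus the pointwise rows F4 consumes, all over landed letters: ✓ `Prop7UntwistChartSplit.norm_mlog_mul_sub_le` ((31)),
✓ `Prop7PinnedRegaugeChartBCH.norm_mlog_twist_sub_pureGauge_le_refined` (refined (Ξ)), ✓ `Prop7CovariantCoercivity.norm_conj_sub_self_le'`, ✓ `MatrixLogLipschitz.norm_mlog_sub_mlog_le`.

WHAT IS PROVED (def-free; `SU(n)` for any nonempty `Fintype n`; ns `…Theorems.Prop7ChartRemainderTrisection`).
* §1 algebra: `regauge_eq_P_mul_Q` (`u·E·W·u₊*·W* = (uEu*)·(uWu₊*W*)`), ★★ `chartRemainder_trisection` (the identity `N = P₁ + P₂ + P₃`, every piece spelled out).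
* §2 sizes (`‖E − 1‖ ≤ 1∕64`, twist `≤ 1∕64`): `norm_P₁_le` (`≤ 2‖u − 1‖·‖log E‖`), `norm_mlog_Q_le` (`‖log Q‖ ≤ 2‖u − Wu₊W*‖`), ★ `norm_P₃_le` (`≤ 4‖log E‖·‖u − Wu₊W*‖`);
  the size of `P₂` IS ✓ `Prop7PinnedRegaugeChartBCH.norm_mlog_twist_sub_pureGauge_le_refined` (`≤ 3‖μ‖·‖μ − Wμ₊W*‖`, `‖u±−1‖ ≤ 1∕64`) — cited, not restated.
* §3 Lipschitz letters for F4: `conj_sub_conj_eq` (`Ad(a)Z − Ad(b)Z = (a−b)Za* + bZ(a−b)*`; the norm row `≤ 2‖a−b‖‖Z‖` IS ✓ `RelativeGauge.norm_conj_sub_conj_le` — cited),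
  ★★ `norm_conj_secondDiff_le` (`‖(Ad a − Ad b)Z − (Ad a′ − Ad b′)Z‖ ≤ (2‖(a−b)−(a′−b′)‖ + ‖a′−b′‖‖a−a′‖ + ‖b−b′‖‖a−b‖)·‖Z‖` — the row that lets F1's product rule act on the
  ψ-DIFFERENCE of `P₁`), `norm_mlog_Q_sub_le` (`‖log Q − log Q′‖ ≤ (64∕61)·‖Q − Q′‖`, `Q = uWu₊*W*`), `norm_Q_sub_Q_le` (`‖Q − Q′‖ ≤ ‖u − u′‖ + ‖u₊ − u₊′‖`).
HONEST SCOPE.  Matrix algebra + landed BCH∕log letters; the `dexp` letter (`P₂ = M_μ(δ) + O(|μ||δ|²)`) and the C^{1,1} row of `exp` are F3; the divergence assembly is F4.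

References: T. Bałaban, CMP 98 (1985) 17–51 [Balaban1985Averaging] ((8), (11) p.19, (21) p.21, (31)–(33) p.22); CMP 102 (1985) 277–309 [Balaban1985Variational]
((15) p.280, (141)–(143) p.299); CMP 99 (1985) 389–434 [Balaban1985BackgroundPropagators] ((3.8) p.392).
-/

set_option autoImplicit false

noncomputable section

open scoped BigOperators Matrix.Norms.L2Operator Matrix
open NormedSpace

namespace Summit.QuantumFields.YangMills.Theorems.Prop7ChartRemainderTrisection

open Literature.MathematicalPhysics.QuantumFieldTheory.Balaban1983to89
open MatrixLog (mlog norm_mlog_le_two_mul)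
open Summit.QuantumFields.YangMills.Theorems.Prop7HolRatioPerStep (coe_star_mul_self coe_mul_star_self norm_coe_eq_one norm_star_coe_eq_one)
open Summit.QuantumFields.YangMills.Theorems.PerturbedPlaquette (norm_conj_SU)
open Summit.QuantumFields.YangMills.Theorems.Prop7CurvedJunctionCovariance (mlog_conj_SU)
open Summit.QuantumFields.YangMills.Theorems.Prop7UntwistChartSplit (norm_mlog_mul_sub_le)
open Summit.QuantumFields.YangMills.Theorems.Prop7PinnedRegaugeChartBCH (norm_mlog_twist_sub_pureGauge_le_refined norm_twist_sub_one_le norm_sub_conj_le)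
open Summit.QuantumFields.YangMills.Theorems.Prop7CovariantCoercivity (norm_conj_sub_self_le')

variable {n : Type*} [Fintype n] [DecidableEq n] [Nonempty n]

/-! ## §1 The exact trisection -/

section Algebra

omit [Nonempty n] in
/-- `u·E·W·u₊*·W* = (u·E·u*)·(u·W·u₊*·W*)` (`u*u = 1`). [cite: Balaban1985Averaging, (8) p.19; Balaban1985Variational, (15) p.280] -/
theorem regauge_eq_P_mul_Q (um up W : Matrix.specialUnitaryGroup n ℂ) (E : Matrix n n ℂ) :
    (um : Matrix n n ℂ) * E * (W : Matrix n n ℂ) * star (up : Matrix n n ℂ) * star (W : Matrix n n ℂ)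
      = ((um : Matrix n n ℂ) * E * star (um : Matrix n n ℂ))
          * ((um : Matrix n n ℂ) * (W : Matrix n n ℂ) * star (up : Matrix n n ℂ) * star (W : Matrix n n ℂ)) := by
  calc _ = (um : Matrix n n ℂ) * E * (star (um : Matrix n n ℂ) * (um : Matrix n n ℂ)) * (W : Matrix n n ℂ) * star (up : Matrix n n ℂ) * star (W : Matrix n n ℂ) := by
        rw [coe_star_mul_self um, mul_one]
    _ = _ := by noncomm_ring

omit [Nonempty n] in
/-- ★★ **THE TRISECTION `N = P₁ + P₂ + P₃`** (an identity of differences; no smallness needed):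
`log(uEWu₊*W*) − log E − (log u − W·log u₊·W*) = [u(log E)u* − log E] + [log(uWu₊*W*) − (log u − W log u₊ W*)] + [log(PQ) − u(log E)u* − log Q]`
with `P = uEu*` (so `log P = u(log E)u*` by ✓ `mlog_conj_SU`), `Q = uWu₊*W*`, `PQ = uEWu₊*W*`. [cite: Balaban1985Averaging, (31) p.22; Balaban1985Variational, (141)-(143) p.299] -/
theorem chartRemainder_trisection (um up W : Matrix.specialUnitaryGroup n ℂ) (E : Matrix n n ℂ) :
    mlog ((um : Matrix n n ℂ) * E * (W : Matrix n n ℂ) * star (up : Matrix n n ℂ) * star (W : Matrix n n ℂ))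
        - mlog E - (mlog (um : Matrix n n ℂ) - (W : Matrix n n ℂ) * mlog (up : Matrix n n ℂ) * star (W : Matrix n n ℂ))
      = ((um : Matrix n n ℂ) * mlog E * star (um : Matrix n n ℂ) - mlog E)
        + (mlog ((um : Matrix n n ℂ) * (W : Matrix n n ℂ) * star (up : Matrix n n ℂ) * star (W : Matrix n n ℂ))
            - (mlog (um : Matrix n n ℂ) - (W : Matrix n n ℂ) * mlog (up : Matrix n n ℂ) * star (W : Matrix n n ℂ)))
        + (mlog (((um : Matrix n n ℂ) * E * star (um : Matrix n n ℂ)) * ((um : Matrix n n ℂ) * (W : Matrix n n ℂ) * star (up : Matrix n n ℂ) * star (W : Matrix n n ℂ)))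
            - (um : Matrix n n ℂ) * mlog E * star (um : Matrix n n ℂ)
            - mlog ((um : Matrix n n ℂ) * (W : Matrix n n ℂ) * star (up : Matrix n n ℂ) * star (W : Matrix n n ℂ))) := by
  rw [← regauge_eq_P_mul_Q]
  abel

omit [Nonempty n] in
/-- `log P = u·(log E)·u*` for `P = u·E·u*`, so `P₃ = log(PQ) − log P − log Q` is the (31)-remainder of the pair `(P, Q)`. [cite: Balaban1985Averaging, (21) p.21] -/
theorem mlog_P_eq (um : Matrix.specialUnitaryGroup n ℂ) (E : Matrix n n ℂ) :
    mlog ((um : Matrix n n ℂ) * E * star (um : Matrix n n ℂ)) = (um : Matrix n n ℂ) * mlog E * star (um : Matrix n n ℂ) :=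
  mlog_conj_SU um E

end Algebra

/-! ## §2 Sizes of the three pieces -/

section Sizes

omit [Nonempty n] in
/-- `‖P₁‖ = ‖u(log E)u* − log E‖ ≤ 2‖u − 1‖·‖log E‖`. [cite: Balaban1985Averaging, (19)-(21) p.21] -/
theorem norm_P₁_le (um : Matrix.specialUnitaryGroup n ℂ) (E : Matrix n n ℂ) :
    ‖(um : Matrix n n ℂ) * mlog E * star (um : Matrix n n ℂ) - mlog E‖ ≤ 2 * ‖(um : Matrix n n ℂ) - 1‖ * ‖mlog E‖ :=
  norm_conj_sub_self_le' um (mlog E)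

/-- `‖log Q‖ ≤ 2‖u − W·u₊·W*‖` for `Q = uWu₊*W*` and twist `≤ 1∕2`. [cite: Balaban1985Averaging, (21) p.21] -/
theorem norm_mlog_Q_le (um up W : Matrix.specialUnitaryGroup n ℂ)
    (hρ : ‖(um : Matrix n n ℂ) - (W : Matrix n n ℂ) * (up : Matrix n n ℂ) * star (W : Matrix n n ℂ)‖ ≤ 1 / 2) :
    ‖mlog ((um : Matrix n n ℂ) * (W : Matrix n n ℂ) * star (up : Matrix n n ℂ) * star (W : Matrix n n ℂ))‖
      ≤ 2 * ‖(um : Matrix n n ℂ) - (W : Matrix n n ℂ) * (up : Matrix n n ℂ) * star (W : Matrix n n ℂ)‖ := by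
  have h1 := norm_twist_sub_one_le um up W
  calc _ ≤ 2 * ‖(um : Matrix n n ℂ) * (W : Matrix n n ℂ) * star (up : Matrix n n ℂ) * star (W : Matrix n n ℂ) - 1‖ :=
        norm_mlog_le_two_mul (h1.trans hρ)
    _ ≤ _ := by linarith

/-- ★ **`‖P₃‖ ≤ 4‖log E‖·‖u − W·u₊·W*‖`** — the (31)-remainder of the pair `(P, Q)` is bilinear in the two `ℓ⁻¹`-small data (`‖E − 1‖ ≤ 1∕64`, twist `≤ 1∕64`).
[cite: Balaban1985Averaging, (31) p.22] -/
theorem norm_P₃_le (um up W : Matrix.specialUnitaryGroup n ℂ) (E : Matrix n n ℂ) (hE : ‖E - 1‖ ≤ 1 / 64)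
    (hρ : ‖(um : Matrix n n ℂ) - (W : Matrix n n ℂ) * (up : Matrix n n ℂ) * star (W : Matrix n n ℂ)‖ ≤ 1 / 64) :
    ‖mlog (((um : Matrix n n ℂ) * E * star (um : Matrix n n ℂ)) * ((um : Matrix n n ℂ) * (W : Matrix n n ℂ) * star (up : Matrix n n ℂ) * star (W : Matrix n n ℂ)))
        - (um : Matrix n n ℂ) * mlog E * star (um : Matrix n n ℂ)
        - mlog ((um : Matrix n n ℂ) * (W : Matrix n n ℂ) * star (up : Matrix n n ℂ) * star (W : Matrix n n ℂ))‖
      ≤ 4 * ‖mlog E‖ * ‖(um : Matrix n n ℂ) - (W : Matrix n n ℂ) * (up : Matrix n n ℂ) * star (W : Matrix n n ℂ)‖ := by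
  -- `P` is `1∕64`-close to `1`, `log P = u (log E) u*`
  have hP1 : ‖(um : Matrix n n ℂ) * E * star (um : Matrix n n ℂ) - 1‖ ≤ 1 / 64 := by
    have hc : (um : Matrix n n ℂ) * E * star (um : Matrix n n ℂ) - 1 = (um : Matrix n n ℂ) * (E - 1) * star (um : Matrix n n ℂ) := by
      rw [mul_sub, sub_mul, mul_one, coe_mul_star_self um]
    rw [hc, norm_conj_SU]; exact hE
  have hlogP : ‖mlog ((um : Matrix n n ℂ) * E * star (um : Matrix n n ℂ))‖ = ‖mlog E‖ := by rw [mlog_P_eq, norm_conj_SU]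
  have hlogE : ‖mlog E‖ ≤ 2 * (1 / 64) := (norm_mlog_le_two_mul (hE.trans (by norm_num))).trans (by linarith)
  have hQ1 : ‖(um : Matrix n n ℂ) * (W : Matrix n n ℂ) * star (up : Matrix n n ℂ) * star (W : Matrix n n ℂ) - 1‖ ≤ 1 / 64 :=
    (norm_twist_sub_one_le um up W).trans hρ
  have hlogQ := norm_mlog_Q_le um up W (hρ.trans (by norm_num))
  have hsum : ‖mlog ((um : Matrix n n ℂ) * E * star (um : Matrix n n ℂ))‖
      + ‖mlog ((um : Matrix n n ℂ) * (W : Matrix n n ℂ) * star (up : Matrix n n ℂ) * star (W : Matrix n n ℂ))‖ ≤ 1 / 5 := by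
    rw [hlogP]; linarith [norm_nonneg ((um : Matrix n n ℂ) - (W : Matrix n n ℂ) * (up : Matrix n n ℂ) * star (W : Matrix n n ℂ))]
  have h31 := norm_mlog_mul_sub_le (hP1.trans_lt (by norm_num)) (hQ1.trans_lt (by norm_num)) hsum
  rw [mlog_P_eq, norm_conj_SU] at h31
  have h0 : 0 ≤ ‖mlog E‖ := norm_nonneg _
  calc _ ≤ 2 * ‖mlog E‖ * ‖mlog ((um : Matrix n n ℂ) * (W : Matrix n n ℂ) * star (up : Matrix n n ℂ) * star (W : Matrix n n ℂ))‖ := h31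
    _ ≤ 2 * ‖mlog E‖ * (2 * ‖(um : Matrix n n ℂ) - (W : Matrix n n ℂ) * (up : Matrix n n ℂ) * star (W : Matrix n n ℂ)‖) :=
        mul_le_mul_of_nonneg_left hlogQ (by positivity)
    _ = _ := by ring

end Sizes

/-! ## §3 Lipschitz letters (for the ψ-differences in F4) -/

section Lipschitz

omit [Nonempty n] in
/-- `a·Z·a* − b·Z·b* = (a − b)·Z·a* + b·Z·(a − b)*`. [folklore] -/
theorem conj_sub_conj_eq (a b Z : Matrix n n ℂ) :
    a * Z * star a - b * Z * star b = (a - b) * Z * star a + b * Z * star (a - b) := by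
  rw [star_sub]; noncomm_ring

/-- ★★ **THE SECOND-DIFFERENCE ROW OF CONJUGATION**: for `a, b, a′, b′ ∈ SU(n)` and any `Z`,
`‖(aZa* − bZb*) − (a′Za′* − b′Zb′*)‖ ≤ (2‖(a−b) − (a′−b′)‖ + ‖a′ − b′‖·‖a − a′‖ + ‖b − b′‖·‖a − b‖)·‖Z‖`
(`aZa* − bZb* = (a−b)Za* + bZ(a−b)*` twice and regroup).  With `a = ũ_μ(x)` (transport of `u(x−e_μ)`), `b = u(x)` and primes for `u′ = e^{−iψ′}` this is the row F1's product rule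
needs on the ψ-DIFFERENCE of `P₁`. [cite: Balaban1985Averaging, (19)-(21) p.21] -/
theorem norm_conj_secondDiff_le (a b a' b' : Matrix.specialUnitaryGroup n ℂ) (Z : Matrix n n ℂ) :
    ‖((a : Matrix n n ℂ) * Z * star (a : Matrix n n ℂ) - (b : Matrix n n ℂ) * Z * star (b : Matrix n n ℂ))
        - ((a' : Matrix n n ℂ) * Z * star (a' : Matrix n n ℂ) - (b' : Matrix n n ℂ) * Z * star (b' : Matrix n n ℂ))‖
      ≤ (2 * ‖((a : Matrix n n ℂ) - (b : Matrix n n ℂ)) - ((a' : Matrix n n ℂ) - (b' : Matrix n n ℂ))‖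
          + ‖(a' : Matrix n n ℂ) - (b' : Matrix n n ℂ)‖ * ‖(a : Matrix n n ℂ) - (a' : Matrix n n ℂ)‖
          + ‖(b : Matrix n n ℂ) - (b' : Matrix n n ℂ)‖ * ‖(a : Matrix n n ℂ) - (b : Matrix n n ℂ)‖) * ‖Z‖ := by
  set A : Matrix n n ℂ := (a : Matrix n n ℂ) with hA
  set B : Matrix n n ℂ := (b : Matrix n n ℂ) with hB
  set A' : Matrix n n ℂ := (a' : Matrix n n ℂ) with hA'
  set B' : Matrix n n ℂ := (b' : Matrix n n ℂ) with hB'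
  have hnA : ‖A‖ = 1 := norm_coe_eq_one a
  have hnB' : ‖B'‖ = 1 := norm_coe_eq_one b'
  have hnsA : ‖star A‖ = 1 := norm_star_coe_eq_one a
  -- regrouping identity
  have e : (A * Z * star A - B * Z * star B) - (A' * Z * star A' - B' * Z * star B')
      = ((A - B) - (A' - B')) * Z * star A + (A' - B') * Z * star (A - A')
        + (B - B') * Z * star (A - B) + B' * Z * star ((A - B) - (A' - B')) := by
    simp only [star_sub]; noncomm_ring
  rw [e]
  have t1 : ‖((A - B) - (A' - B')) * Z * star A‖ ≤ ‖(A - B) - (A' - B')‖ * ‖Z‖ := by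
    calc _ ≤ ‖((A - B) - (A' - B')) * Z‖ * ‖star A‖ := norm_mul_le _ _
      _ ≤ (‖(A - B) - (A' - B')‖ * ‖Z‖) * 1 := by rw [hnsA]; exact mul_le_mul_of_nonneg_right (norm_mul_le _ _) zero_le_one
      _ = _ := mul_one _
  have t2 : ‖(A' - B') * Z * star (A - A')‖ ≤ ‖A' - B'‖ * ‖A - A'‖ * ‖Z‖ := by
    calc _ ≤ ‖(A' - B') * Z‖ * ‖star (A - A')‖ := norm_mul_le _ _
      _ ≤ (‖A' - B'‖ * ‖Z‖) * ‖A - A'‖ := by rw [norm_star]; exact mul_le_mul_of_nonneg_right (norm_mul_le _ _) (norm_nonneg _)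
      _ = _ := by ring
  have t3 : ‖(B - B') * Z * star (A - B)‖ ≤ ‖B - B'‖ * ‖A - B‖ * ‖Z‖ := by
    calc _ ≤ ‖(B - B') * Z‖ * ‖star (A - B)‖ := norm_mul_le _ _
      _ ≤ (‖B - B'‖ * ‖Z‖) * ‖A - B‖ := by rw [norm_star]; exact mul_le_mul_of_nonneg_right (norm_mul_le _ _) (norm_nonneg _)
      _ = _ := by ring
  have t4 : ‖B' * Z * star ((A - B) - (A' - B'))‖ ≤ ‖(A - B) - (A' - B')‖ * ‖Z‖ := by
    calc _ ≤ ‖B' * Z‖ * ‖star ((A - B) - (A' - B'))‖ := norm_mul_le _ _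
      _ ≤ (‖B'‖ * ‖Z‖) * ‖(A - B) - (A' - B')‖ := by rw [norm_star]; exact mul_le_mul_of_nonneg_right (norm_mul_le _ _) (norm_nonneg _)
      _ = _ := by rw [hnB']; ring
  calc _ ≤ ‖((A - B) - (A' - B')) * Z * star A + (A' - B') * Z * star (A - A') + (B - B') * Z * star (A - B)‖ + ‖B' * Z * star ((A - B) - (A' - B'))‖ :=
        norm_add_le _ _
    _ ≤ (‖((A - B) - (A' - B')) * Z * star A + (A' - B') * Z * star (A - A')‖ + ‖(B - B') * Z * star (A - B)‖) + ‖B' * Z * star ((A - B) - (A' - B'))‖ := by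
        gcongr; exact norm_add_le _ _
    _ ≤ ((‖((A - B) - (A' - B')) * Z * star A‖ + ‖(A' - B') * Z * star (A - A')‖) + ‖(B - B') * Z * star (A - B)‖) + ‖B' * Z * star ((A - B) - (A' - B'))‖ := by
        gcongr; exact norm_add_le _ _
    _ ≤ _ := by nlinarith [t1, t2, t3, t4, norm_nonneg Z]

/-- `‖Q − Q′‖ ≤ ‖u − u′‖ + ‖u₊ − u₊′‖` for `Q = uWu₊*W*`, `Q′ = u′Wu₊′*W*` (all unitaries have norm one). [folklore] -/
theorem norm_Q_sub_Q_le (um up um' up' W : Matrix.specialUnitaryGroup n ℂ) :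
    ‖(um : Matrix n n ℂ) * (W : Matrix n n ℂ) * star (up : Matrix n n ℂ) * star (W : Matrix n n ℂ)
        - (um' : Matrix n n ℂ) * (W : Matrix n n ℂ) * star (up' : Matrix n n ℂ) * star (W : Matrix n n ℂ)‖
      ≤ ‖(um : Matrix n n ℂ) - (um' : Matrix n n ℂ)‖ + ‖(up : Matrix n n ℂ) - (up' : Matrix n n ℂ)‖ := by
  have e : (um : Matrix n n ℂ) * (W : Matrix n n ℂ) * star (up : Matrix n n ℂ) * star (W : Matrix n n ℂ)
        - (um' : Matrix n n ℂ) * (W : Matrix n n ℂ) * star (up' : Matrix n n ℂ) * star (W : Matrix n n ℂ)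
      = ((um : Matrix n n ℂ) - (um' : Matrix n n ℂ)) * ((W : Matrix n n ℂ) * star (up : Matrix n n ℂ) * star (W : Matrix n n ℂ))
        + (um' : Matrix n n ℂ) * (W : Matrix n n ℂ) * star ((up : Matrix n n ℂ) - (up' : Matrix n n ℂ)) * star (W : Matrix n n ℂ) := by
    rw [star_sub]; noncomm_ring
  rw [e]
  have hV : ‖(W : Matrix n n ℂ) * star (up : Matrix n n ℂ) * star (W : Matrix n n ℂ)‖ ≤ 1 := by
    calc _ ≤ ‖(W : Matrix n n ℂ) * star (up : Matrix n n ℂ)‖ * ‖star (W : Matrix n n ℂ)‖ := norm_mul_le _ _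
      _ ≤ (‖(W : Matrix n n ℂ)‖ * ‖star (up : Matrix n n ℂ)‖) * ‖star (W : Matrix n n ℂ)‖ := by gcongr; exact norm_mul_le _ _
      _ = 1 := by rw [norm_coe_eq_one, norm_star_coe_eq_one, norm_star_coe_eq_one]; ring
  have h1 : ‖((um : Matrix n n ℂ) - (um' : Matrix n n ℂ)) * ((W : Matrix n n ℂ) * star (up : Matrix n n ℂ) * star (W : Matrix n n ℂ))‖ ≤ ‖(um : Matrix n n ℂ) - (um' : Matrix n n ℂ)‖ := by
    calc _ ≤ ‖(um : Matrix n n ℂ) - (um' : Matrix n n ℂ)‖ * ‖(W : Matrix n n ℂ) * star (up : Matrix n n ℂ) * star (W : Matrix n n ℂ)‖ := norm_mul_le _ _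
      _ ≤ ‖(um : Matrix n n ℂ) - (um' : Matrix n n ℂ)‖ * 1 := by gcongr
      _ = _ := mul_one _
  have h2 : ‖(um' : Matrix n n ℂ) * (W : Matrix n n ℂ) * star ((up : Matrix n n ℂ) - (up' : Matrix n n ℂ)) * star (W : Matrix n n ℂ)‖ ≤ ‖(up : Matrix n n ℂ) - (up' : Matrix n n ℂ)‖ := by
    calc _ ≤ ‖(um' : Matrix n n ℂ) * (W : Matrix n n ℂ) * star ((up : Matrix n n ℂ) - (up' : Matrix n n ℂ))‖ * ‖star (W : Matrix n n ℂ)‖ := norm_mul_le _ _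
      _ ≤ ((‖(um' : Matrix n n ℂ)‖ * ‖(W : Matrix n n ℂ)‖) * ‖star ((up : Matrix n n ℂ) - (up' : Matrix n n ℂ))‖) * ‖star (W : Matrix n n ℂ)‖ := by
          gcongr
          exact (norm_mul_le _ _).trans (mul_le_mul_of_nonneg_right (norm_mul_le _ _) (norm_nonneg _))
      _ = ‖(up : Matrix n n ℂ) - (up' : Matrix n n ℂ)‖ := by
          rw [norm_coe_eq_one, norm_coe_eq_one, norm_star_coe_eq_one, norm_star]; ring
  exact (norm_add_le _ _).trans (add_le_add h1 h2)

/-- `‖log Q − log Q′‖ ≤ (64∕61)·‖Q − Q′‖` for twists `≤ 3∕64` (✓ `norm_mlog_sub_mlog_le` at `r = 3∕64`). [cite: Balaban1985Averaging, (21) p.21] -/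
theorem norm_mlog_Q_sub_le (um up um' up' W : Matrix.specialUnitaryGroup n ℂ)
    (hρ : ‖(um : Matrix n n ℂ) - (W : Matrix n n ℂ) * (up : Matrix n n ℂ) * star (W : Matrix n n ℂ)‖ ≤ 3 / 64)
    (hρ' : ‖(um' : Matrix n n ℂ) - (W : Matrix n n ℂ) * (up' : Matrix n n ℂ) * star (W : Matrix n n ℂ)‖ ≤ 3 / 64) :
    ‖mlog ((um : Matrix n n ℂ) * (W : Matrix n n ℂ) * star (up : Matrix n n ℂ) * star (W : Matrix n n ℂ))
        - mlog ((um' : Matrix n n ℂ) * (W : Matrix n n ℂ) * star (up' : Matrix n n ℂ) * star (W : Matrix n n ℂ))‖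
      ≤ (64 / 61) * ‖(um : Matrix n n ℂ) * (W : Matrix n n ℂ) * star (up : Matrix n n ℂ) * star (W : Matrix n n ℂ)
          - (um' : Matrix n n ℂ) * (W : Matrix n n ℂ) * star (up' : Matrix n n ℂ) * star (W : Matrix n n ℂ)‖ := by
  have hQ : ‖(um : Matrix n n ℂ) * (W : Matrix n n ℂ) * star (up : Matrix n n ℂ) * star (W : Matrix n n ℂ) - 1‖ ≤ 3 / 64 :=
    (norm_twist_sub_one_le um up W).trans hρ
  have hQ' : ‖(um' : Matrix n n ℂ) * (W : Matrix n n ℂ) * star (up' : Matrix n n ℂ) * star (W : Matrix n n ℂ) - 1‖ ≤ 3 / 64 :=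
    (norm_twist_sub_one_le um' up' W).trans hρ'
  have h := MatrixLogLipschitz.norm_mlog_sub_mlog_le (by norm_num : (3 : ℝ) / 64 < 1) hQ hQ'
  refine h.trans (le_of_eq ?_)
  rw [div_eq_mul_inv, mul_comm]
  norm_num

end Lipschitz

end Summit.QuantumFields.YangMills.Theorems.Prop7ChartRemainderTrisection

end
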